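import Summits.ResolutionOfSingularities.ResolutionOfSingularities.Theorems.EquisingularLiftEquisingularLiftNatInCarrierStepExact
import HarnessLib

/-!
# [OURS · L1 W4.5(b) · EL♮(3)] HSUB′(ReachTower₁) inner chain — EXACTNESS OF THE CONE ALONE along the regular in-carrier point step
# (the K-alone form of K7c `comap_strictTransformIdeal_carrierPair_eq_sup`, p533779; input of the `…K` twins of (A)/(B))
# (crux `EquisingularLiftNatThree` = stmt-ResolutionOfSingularities-20148, parent `EquisingularLiftNat` = stmt-…-20038)

HONEST FRAMING. OURS (cell res-hironaka, crux chain w45b, slot W4.5(b)); NOT a statement of any manuscript; AI-written, weaker than expert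
review. Helper `--supports stmt-ResolutionOfSingularities-20148 --as helper`; closes nothing; no `sorry`; standard axioms; DEF-FREE.
res-L1-w45b-stub-4 for res-D-pv-029 g8's (S2) ASK 2026-08-27T16:37:13Z («(vii)′ from (vii) is 10 lines — `comap_strictTransformIdeal_eq_of_model`
for K alone with the degree-one pack»). The proof is the K7c proof with ONE cone pack instead of two.

* `comap_strictTransformIdeal_cone_eq_of_regularPoint` — in the model square of the section blow-up `τ` of `ker s` over the point blow-up `υ`
  of `x`, for an in-carrier pair `(𝓢, K)` (`𝓢 ⊔ K ≤ ker s`) with principal stalks at `j x` and `𝒪_{X′,j x}/(𝓢 ⊔ K)` regular of codimension 2: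
  `(St_τ K)·𝒪_{F₂} = St_υ (K·𝒪_{F₁})`.

References: U. Görtz, T. Wedhorn, *Algebraic Geometry I* (2020), Prop. 13.91, Rem. 13.92 [GortzWedhorn2020]; H. Matsumura, *Commutative Ring
Theory* (1986), Thm. 14.2 [Matsumura1987] — through the cited tree files (…NatStrictTransformComap, …NatInCarrierStepExact).
-/

set_option linter.dupNamespace false -- mandated namespace `Summit.<Summit>.<Problem>` of this single-conjunct summit
set_option linter.overlappingInstances false -- signatures carry `[IsDomain O] [IsDiscreteValuationRing O]`

noncomputable section

open CategoryTheory CategoryTheory.Limits AlgebraicGeometry TopologicalSpace Topology IsLocalRing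
open Literature.AlgebraicGeometry.Resolution
open AlgebraicGeometry.Scheme.IdealSheafData
open Summit.ResolutionOfSingularities.ResolutionOfSingularities.Theses.EquisingularLift.Split
open Summit.ResolutionOfSingularities.ResolutionOfSingularities.Cruxes.EquisingularLift.StrataSplit

namespace Summit.ResolutionOfSingularities.ResolutionOfSingularities.Cruxes.EquisingularLiftNat.Sections

section ConeExact

variable (O : Type) [CommRing O] [IsDomain O] [IsDiscreteValuationRing O] (k : Type) [Field k] (θ : O →+* k)

/-- **Exactness of the cone ALONE along the regular in-carrier step** (K-alone form of K7c `comap_strictTransformIdeal_carrierPair_eq_sup`):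
`(St_τ K).comap j₂ = St_υ (K.comap j)`. [cite: GortzWedhorn2020, Prop. 13.91] [cite: Matsumura1987, Thm. 14.2] [OURS · L1 W4.5b] toward
`stub_elnat_coneTowerPointResolution` (stmt-ResolutionOfSingularities-20148); NOT a statement of the manuscript. -/
theorem comap_strictTransformIdeal_cone_eq_of_regularPoint (hθ : Function.Surjective θ) {X' X₁ F₁ F₂ : Scheme.{0}}
    (r' : X' ⟶ Spec (.of O)) [IsSeparated r'] [IsLocallyNoetherian X₁] [IsLocallyNoetherian F₂] [IsIntegral F₁] [IsIntegral F₂]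
    [IsLocallyNoetherian F₁] (j : F₁ ⟶ X') (t : F₁ ⟶ Spec (.of k))
    (hsq : IsPullback j t r' (Spec.map (CommRingCat.ofHom θ)))
    (s : Spec (.of O) ⟶ X') (hs : s ≫ r' = 𝟙 _) (τ : X₁ ⟶ X') (hτ : IsBlowup τ s.ker)
    (υ : F₂ ⟶ F₁) (j₂ : F₂ ⟶ X₁) (hcomm : j₂ ≫ τ = υ ≫ j) (x : F₁) (hx : IsClosed ({x} : Set F₁))
    (hυ : IsBlowup υ (vanishingIdeal ⟨{x}, hx⟩)) (hJ : s.ker.comap j = vanishingIdeal ⟨{x}, hx⟩)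
    (hsx : s (closedPoint O) = j x) (hreg : IsRegularLocalRing (X'.presheaf.stalk (j x))) (ϖ : O) (hϖ : Irreducible ϖ)
    -- the in-carrier pair
    (𝓢 K : X'.IdealSheafData) (hle : 𝓢 ⊔ K ≤ s.ker) (h𝓢p : (stalkIdeal 𝓢 (j x)).IsPrincipal)
    (hKp : (stalkIdeal K (j x)).IsPrincipal)
    (hDreg : IsRegularLocalRing (X'.presheaf.stalk (j x) ⧸ stalkIdeal (𝓢 ⊔ K) (j x)))
    (hDdim : ringKrullDim (X'.presheaf.stalk (j x) ⧸ stalkIdeal (𝓢 ⊔ K) (j x)) + 2 =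
      ringKrullDim (X'.presheaf.stalk (j x))) :
    (strictTransformIdeal τ s.ker K).comap j₂ = strictTransformIdeal υ (vanishingIdeal ⟨{x}, hx⟩) (K.comap j) := by
  classical
  haveI := hreg
  have hϖO : ϖ ∈ maximalIdeal O := by rw [hϖ.maximalIdeal_eq]; exact Ideal.mem_span_singleton_self ϖ
  -- (1) a section frame at `j x`
  obtain ⟨n, c, θR, hcI, hc, hdom, -, h𝔪, hϖc, -⟩ := exists_sectionFrame_forall_dim_at O r' s hs (j x) hsx hreg ϖ hϖ
  haveI := hdom
  have hc𝔪 : ∀ i, c i ∈ maximalIdeal (X'.presheaf.stalk (j x)) := fun i => by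
    rw [← h𝔪]; exact Ideal.mem_sup_left (Ideal.subset_span ⟨i, rfl⟩)
  have hI𝔪 : Ideal.span (Set.range c) ≤ maximalIdeal _ := Ideal.span_le.mpr (by rintro _ ⟨i, rfl⟩; exact hc𝔪 i)
  -- (2) local equations `h`, `f`
  obtain ⟨h, hh⟩ := h𝓢p.principal
  obtain ⟨f, hf⟩ := hKp.principal
  change stalkIdeal 𝓢 (j x) = Ideal.span {h} at hh
  change stalkIdeal K (j x) = Ideal.span {f} at hf
  have hsum : stalkIdeal (𝓢 ⊔ K) (j x) = Ideal.span {h} ⊔ Ideal.span {f} := by rw [stalkIdeal_sup, hh, hf]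
  have h𝓢le : stalkIdeal 𝓢 (j x) ≤ Ideal.span (Set.range c) := hcI ▸ stalkIdeal_mono (le_sup_left.trans hle) (j x)
  have hKle : stalkIdeal K (j x) ≤ Ideal.span (Set.range c) := hcI ▸ stalkIdeal_mono (le_sup_right.trans hle) (j x)
  have hhc : h ∈ Ideal.span (Set.range c) := h𝓢le (hh ▸ Ideal.mem_span_singleton_self h)
  have hfc : f ∈ Ideal.span (Set.range c) := hKle (hf ▸ Ideal.mem_span_singleton_self f)
  have hhm : h ∈ maximalIdeal _ := hI𝔪 hhc
  have hfm : f ∈ maximalIdeal _ := hI𝔪 hfc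
  -- (3) codimension two forces order one
  haveI : IsRegularLocalRing (X'.presheaf.stalk (j x) ⧸ (Ideal.span {h} ⊔ Ideal.span {f})) := by rw [← hsum]; exact hDreg
  have hdim' : ringKrullDim (X'.presheaf.stalk (j x) ⧸ (Ideal.span {h} ⊔ Ideal.span {f})) + 2 =
      ringKrullDim (X'.presheaf.stalk (j x)) := by rw [← hsum]; exact hDdim
  obtain ⟨hf2, -⟩ := notMem_sq_of_isRegularLocalRing_quotient_codim_two' hhm hfm hdim'
  -- (4) the order-one cone packs
  have hg : Ideal.span (Set.range fun i => (j.stalkMap x).hom (c i)) ≠ ⊤ := by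
    rw [span_stalkMap_eq_maximalIdeal_of_model θ hθ r' j t hsq x ϖ hϖO c h𝔪]
    exact (maximalIdeal.isMaximal _).ne_top
  obtain ⟨Φf, hΦf1, hΦfev, hΦfc, hΦfbar⟩ := exists_linearForm_conePack c hc𝔪 hfc hf2 (j.stalkMap x).hom hg
  have hcbar : IsQuasiRegular (fun i => (j.stalkMap x).hom (c i)) :=
    isQuasiRegular_stalkMap_model O k θ hθ r' j t hsq x c hc ϖ hϖ hϖc
  -- (5) F⁺5 twice
  exact comap_strictTransformIdeal_eq_of_model τ s.ker K hτ j υ j₂ hcomm x hx hυ hJ c hcI hc Φf hΦf1 hΦfc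
    (by rw [hΦfev]; exact hf) hcbar hΦfbar

end ConeExact

end Summit.ResolutionOfSingularities.ResolutionOfSingularities.Cruxes.EquisingularLiftNat.Sections

end
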